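import Literature.AlgebraicGeometry.Pohlmann1968.NondegenerateCMTypeFamilies
import Summits.HodgeConjecture.CorCM.QuarticCMTypeReflection
import HarnessLib

/-!
# CM types of a QUARTIC CM field, II: the nondegenerate PAIR family `(Φ, Ψ)`, `Ψ ∉ {Φ, Φ̄}`

COR-CM (cell `pub-hodgecm2`), seat b24, count-neutral lane QUARTIC-SLICE; sequel of `CorCM/QuarticCMTypeReflection.lean`
(four embeddings `a, ā, b, b̄`; the reflection `τ ∈ Aut(ℂ)`, `τa = a`, `τb = b̄`, of a non-Galois quartic CM field).
Everything is PROVED; theorems only; no definition, no named fact.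

* `cmType_eq_of_subset`, `mem_flip_iff_of_pair` (`Φ^{(b)} = {a, b̄}`), `type_eq_or_eq_or_eq_or_eq` (the four CM types are
  `Φ, Φ̄, Φ^{(b)}, \overline{Φ^{(b)}}`), `isPrimitive_of_fourCycle` (bookkeeping for the slice).
* `exists_ringAut_fourCycle` — a four-cycle `μ ∈ Aut(ℂ)`, `μa = b`, `μb = ā` (transitivity + the reflection).
* **`isNondegenerateFamily_pair`**, **`isNondegenerateFamily_pair_of_not_isGalois`** — for `Φ = {a, b}`, `Ψ = {a, b̄}`
  the family `(Φ, Ψ)` is NONDEGENERATE (`Pohlmann1968.IsNondegenerateFamily ![Φ, Ψ]`, rank `5 = 2·2 + 1`): an `ℕ`-weight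
  on `{0,1} × Hom(K, ℂ)` satisfying Pohlmann's Galois condition at `1, τ, μ, μτ` is conjugation-invariant — four linear
  identities in eight multiplicities (`Pohlmann1968.isNondegenerateFamily_iff_forall_nat_symm`).  Hence every pair of CM
  types `Ψ ∉ {Φ, Φ̄}` of a NON-GALOIS quartic CM field is a nondegenerate family — the first nondegenerate family with two
  (primitive, CM-inequivalent) members; over a GALOIS CM field there is none (`GaloisCMFieldExoticProducts`,
  `not_isNondegenerateFamily_of_two_le_card`).  Geometric content (`Pohlmann1968.IsNondegenerateFamily.hodgeConjectureFor_prod`,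
  unconditional): every `A^k × A′^l` for realisations `A, A′` of `Φ, Ψ` — two NON-ISOGENOUS simple CM abelian surfaces
  with the same quartic CM field — has `B• = D•` and satisfies the Hodge conjecture.
Print counterpart: Moonen–Zarhin 1999, section "Hodge groups of simple abelian surfaces of CM-type" («in case (2) there
are two such isogeny classes»; Proposition «`X₁ ≁ X₂` ⟹ `Hg(X) = Hg(X₁) × Hg(X₂)`»), with Hazama–Murty (Gordon 7.5).

## References
* [MoonenZarhin1999LowDim] B. Moonen, Yu. Zarhin, Math. Ann. 315 (1999) 711–733, section "Hodge groups of simple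
  abelian surfaces of CM-type".
* [Gordon1999HodgeAVSurvey] B. B. Gordon, *A survey of the Hodge conjecture for abelian varieties*, 7.5, §9.2–9.3.
-/

noncomputable section

open NumberField NumberField.ComplexEmbedding
open scoped Cardinal

namespace Summit.HodgeConjecture.CorCM.QuarticCM

open Literature.NumberTheory.ComplexMultiplication
open Literature.NumberTheory.ComplexMultiplication.CMTypeOps (bar mem_bar_iff conjugate_mem_iff_notMem
  mem_iff_conjugate_notMem)
open Literature.AlgebraicGeometry.Motives (CMType)
open Literature.AlgebraicGeometry.Pohlmann1968
open Summit.HodgeConjecture.CorCM.CyclicSextic (conjugate_eq_comp_conjGal orderOf_conjGal)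

variable {K : Type} [Field K] [NumberField K] [IsCMField K]


omit [NumberField K] [IsCMField K] in
/-- Two CM types one of which contains the other are equal (`Φ̄` is the complement of `Φ`). [folklore] -/
theorem cmType_eq_of_subset {T T' : CMType K} (h : T.1 ⊆ T'.1) : T = T' := by
  refine Subtype.ext (Set.ext fun s => ⟨fun hs => h hs, fun hs => ?_⟩)
  by_contra hns
  exact (mem_iff_conjugate_notMem T' s).1 hs (h ((conjugate_mem_iff_notMem T s).2 hns))

/-- The flipped type `Φ^{(b)} = {a, b̄}` of `Φ = {a, b}` (`CMTypeOps.flip`). [folklore] -/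
theorem mem_flip_iff_of_pair (h4 : Module.finrank ℚ K = 4) {a b : K →+* ℂ} (hba : b ≠ a) (hba' : b ≠ conjugate a)
    {Φ : CMType K} (hΦ : ∀ s, s ∈ Φ.1 ↔ s = a ∨ s = b) (s : K →+* ℂ) :
    s ∈ (CMTypeOps.flip b Φ).1 ↔ s = a ∨ s = conjugate b := by
  have hab' : conjugate b ≠ a := fun h => hba' (by rw [← h, involutive_conjugate K b])
  have hcc : conjugate b ≠ conjugate a := fun h => hba ((involutive_conjugate K).injective h)
  rw [CMTypeOps.mem_flip_iff, hΦ]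
  simp only [CMTypeOps.placeSet, Set.mem_insert_iff, Set.mem_singleton_iff]
  rcases eq_or_eq_or_eq_or_eq h4 hba hba' s with h | h | h | h <;> rw [h] <;>
    simp [conjugate_ne a, conjugate_ne b, (conjugate_ne b).symm, hba, hab', hba.symm, hba'.symm, hab'.symm, hcc.symm]

/-- **The four CM types of a quartic CM field**: with `Φ = {a, b}` and `Ψ = {a, b̄}`, every CM type is one of
`Φ, Φ̄, Ψ, Ψ̄` (it contains one of `a, ā` and one of `b, b̄`). [folklore] -/
theorem type_eq_or_eq_or_eq_or_eq (h4 : Module.finrank ℚ K = 4) {a b : K →+* ℂ} (hba : b ≠ a) (hba' : b ≠ conjugate a)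
    {Φ Ψ : CMType K} (hΦ : ∀ s, s ∈ Φ.1 ↔ s = a ∨ s = b) (hΨ : ∀ s, s ∈ Ψ.1 ↔ s = a ∨ s = conjugate b)
    (Θ : CMType K) : Θ = Φ ∨ Θ = bar Φ ∨ Θ = Ψ ∨ Θ = bar Ψ := by
  have hab' : conjugate b ≠ a := fun h => hba' (by rw [← h, involutive_conjugate K b])
  have hcc : conjugate b ≠ conjugate a := fun h => hba ((involutive_conjugate K).injective h)
  have hΘna : conjugate a ∈ Θ.1 ↔ a ∉ Θ.1 := conjugate_mem_iff_notMem Θ a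
  have hΘnb : conjugate b ∈ Θ.1 ↔ b ∉ Θ.1 := conjugate_mem_iff_notMem Θ b
  -- the value of a type on the four embeddings, from its values at `a` and `b`
  have key : ∀ (T : CMType K) (p q : Prop), (a ∈ T.1 ↔ p) → (b ∈ T.1 ↔ q) →
      ∀ s, s ∈ T.1 ↔ (s = a ∧ p) ∨ (s = conjugate a ∧ ¬p) ∨ (s = b ∧ q) ∨ (s = conjugate b ∧ ¬q) := by
    intro T p q hp hq s
    have hTna : conjugate a ∈ T.1 ↔ a ∉ T.1 := conjugate_mem_iff_notMem T a
    have hTnb : conjugate b ∈ T.1 ↔ b ∉ T.1 := conjugate_mem_iff_notMem T b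
    rcases eq_or_eq_or_eq_or_eq h4 hba hba' s with h | h | h | h <;> rw [h]
    · simp only [true_and, (conjugate_ne a).symm, hba.symm, hab'.symm, false_and, or_false]; exact hp
    · simp only [conjugate_ne a, false_and, true_and, hba'.symm, hcc.symm, false_or, or_false]; rw [hTna, hp]
    · simp only [hba, hba', false_and, true_and, (conjugate_ne b).symm, false_or, or_false]; exact hq
    · simp only [hab', hcc, conjugate_ne b, false_and, true_and, false_or]; rw [hTnb, hq]
  have hΦ' := key Φ True True (iff_true_intro ((hΦ a).2 (Or.inl rfl))) (iff_true_intro ((hΦ b).2 (Or.inr rfl)))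
  have hΨ' := key Ψ True False (iff_true_intro ((hΨ a).2 (Or.inl rfl)))
    (iff_false_intro fun h => (mem_iff_conjugate_notMem Ψ b).1 h ((hΨ (conjugate b)).2 (Or.inr rfl)))
  by_cases hΘa : a ∈ Θ.1 <;> by_cases hΘb : b ∈ Θ.1
  · refine Or.inl (Subtype.ext (Set.ext fun s => ?_))
    rw [key Θ True True (iff_true_intro hΘa) (iff_true_intro hΘb), hΦ']
  · refine Or.inr (Or.inr (Or.inl (Subtype.ext (Set.ext fun s => ?_))))
    rw [key Θ True False (iff_true_intro hΘa) (iff_false_intro hΘb), hΨ']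
  · refine Or.inr (Or.inr (Or.inr (Subtype.ext (Set.ext fun s => ?_))))
    rw [key Θ False True (iff_false_intro hΘa) (iff_true_intro hΘb), mem_bar_iff, hΨ']
    rcases eq_or_eq_or_eq_or_eq h4 hba hba' s with h | h | h | h <;> rw [h] <;>
      simp [conjugate_ne a, (conjugate_ne a).symm, conjugate_ne b, (conjugate_ne b).symm, hba, hba', hab', hcc,
        hba.symm, hba'.symm, hab'.symm, hcc.symm]
  · refine Or.inr (Or.inl (Subtype.ext (Set.ext fun s => ?_)))
    rw [key Θ False False (iff_false_intro hΘa) (iff_false_intro hΘb), mem_bar_iff, hΦ']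
    rcases eq_or_eq_or_eq_or_eq h4 hba hba' s with h | h | h | h <;> rw [h] <;>
      simp [conjugate_ne a, (conjugate_ne a).symm, conjugate_ne b, (conjugate_ne b).symm, hba, hba', hab', hcc,
        hba.symm, hba'.symm, hab'.symm, hcc.symm]

/-- **With a four-cycle at hand, `Φ = {a, b}` is primitive** (`1` and `μ` separate the four embeddings: `μa = b ∈ Φ`,
`μb = ā ∉ Φ`). [cite: Shimura1998, §8.2 Prop. 26] -/
theorem isPrimitive_of_fourCycle (h4 : Module.finrank ℚ K = 4) {a b : K →+* ℂ} (hba : b ≠ a)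
    (hba' : b ≠ conjugate a) {μ : ℂ ≃+* ℂ} (hμa : μ • a = b) (hμb : μ • b = conjugate a)
    (Φ : CMType K) (hΦ : ∀ s, s ∈ Φ.1 ↔ s = a ∨ s = b) (φ₀ : K →+* ℂ) :
    IsPrimitive (ℂ ≃+* ℂ) Φ.1 φ₀ := by
  haveI := isPretransitive_ringEquiv_complex (K := K)
  rw [isPrimitive_iff_forall_eq]
  intro x y hxy
  have ha : a ∈ Φ.1 := (hΦ a).2 (Or.inl rfl)
  have hb : b ∈ Φ.1 := (hΦ b).2 (Or.inr rfl)
  have hna : conjugate a ∉ Φ.1 := (mem_iff_conjugate_notMem Φ a).1 ha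
  have hnb : conjugate b ∉ Φ.1 := (mem_iff_conjugate_notMem Φ b).1 hb
  have hμa' : μ • conjugate a = conjugate b := by rw [smul_conjugate, hμa]
  have hμb' : μ • conjugate b = a := by rw [smul_conjugate, hμb, involutive_conjugate]
  have h1 := hxy 1
  have h2 := hxy μ
  simp only [one_smul] at h1
  rcases eq_or_eq_or_eq_or_eq h4 hba hba' x with hx | hx | hx | hx <;>
    rcases eq_or_eq_or_eq_or_eq h4 hba hba' y with hy | hy | hy | hy <;>
    rw [hx, hy] at h1 h2 ⊢ <;>
    first
    | rfl
    | (exfalso; simp only [hμa, hμa', hμb, hμb'] at h2; tauto)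

/-- A four-cycle `μ ∈ Aut(ℂ)` on the embeddings: `μa = b`, `μb = ā` (from any `σ` with `σa = b` — transitivity —
and the reflection `τ`). [folklore] -/
theorem exists_ringAut_fourCycle (h4 : Module.finrank ℚ K = 4) {a b : K →+* ℂ} (hba : b ≠ a)
    (hba' : b ≠ conjugate a) {τ : ℂ ≃+* ℂ} (hτa : τ • a = a) (hτb : τ • b = conjugate b) :
    ∃ μ : ℂ ≃+* ℂ, μ • a = b ∧ μ • b = conjugate a := by
  haveI := isPretransitive_ringEquiv_complex (K := K)
  obtain ⟨σ, hσ⟩ := MulAction.exists_smul_eq (ℂ ≃+* ℂ) a b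
  rcases eq_or_eq_or_eq_or_eq h4 hba hba' (σ • b) with h | h | h | h
  · exact ⟨σ * τ, by rw [mul_smul, hτa, hσ], by rw [mul_smul, hτb, smul_conjugate, h]⟩
  · exact ⟨σ, hσ, h⟩
  · exact absurd (smul_left_cancel σ (h.trans hσ.symm)) hba
  · refine absurd (smul_left_cancel σ (h.trans ?_)) hba'
    rw [smul_conjugate, hσ]

/-- **The pair family is nondegenerate.**  For a quartic CM field, `Φ = {a, b}`, `Ψ = {a, b̄}` and a reflection
`τ` (`τa = a`, `τb = b̄`), the family `(Φ, Ψ)` has `Rank = 5 = 2·2 + 1` (`Pohlmann1968.IsNondegenerateFamily`): every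
`ℕ`-weight on `{0,1} × Hom(K, ℂ)` satisfying Pohlmann's Galois condition is conjugation-invariant — balance at
`1, τ, μ, μτ` (`μ` a four-cycle) gives four linear identities in the eight multiplicities which force it
(`Pohlmann1968.isNondegenerateFamily_iff_forall_nat_symm`).  Geometric content
(`Pohlmann1968.IsNondegenerateFamily.hodgeConjectureFor_prod`): every `A^k × A′^l` for realisations `A, A′` of
`Φ, Ψ` — two non-isogenous simple CM abelian surfaces with the same quartic CM field — has `B• = D•` and satisfies
the Hodge conjecture. [cite: MoonenZarhin1999LowDim, section "Hodge groups of simple abelian surfaces of CM-type"] -/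
theorem isNondegenerateFamily_pair (h4 : Module.finrank ℚ K = 4) {a b : K →+* ℂ} (hba : b ≠ a)
    (hba' : b ≠ conjugate a) {τ : ℂ ≃+* ℂ} (hτa : τ • a = a) (hτb : τ • b = conjugate b) {Φ Ψ : CMType K}
    (hΦ : ∀ s, s ∈ Φ.1 ↔ s = a ∨ s = b) (hΨ : ∀ s, s ∈ Ψ.1 ↔ s = a ∨ s = conjugate b) :
    IsNondegenerateFamily ![Φ, Ψ] := by
  classical
  have hab' : conjugate b ≠ a := fun h => hba' (by rw [← h, involutive_conjugate K b])
  have hcc : conjugate b ≠ conjugate a := fun h => hba ((involutive_conjugate K).injective h)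
  -- membership tables
  have hΦa : a ∈ Φ.1 := (hΦ a).2 (Or.inl rfl)
  have hΦb : b ∈ Φ.1 := (hΦ b).2 (Or.inr rfl)
  have hΦna : conjugate a ∉ Φ.1 := (mem_iff_conjugate_notMem Φ a).1 hΦa
  have hΦnb : conjugate b ∉ Φ.1 := (mem_iff_conjugate_notMem Φ b).1 hΦb
  have hΨa : a ∈ Ψ.1 := (hΨ a).2 (Or.inl rfl)
  have hΨb' : conjugate b ∈ Ψ.1 := (hΨ (conjugate b)).2 (Or.inr rfl)
  have hΨna : conjugate a ∉ Ψ.1 := (mem_iff_conjugate_notMem Ψ a).1 hΨa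
  have hΨnb : b ∉ Ψ.1 := fun h => (mem_iff_conjugate_notMem Ψ b).1 h hΨb'
  -- the group elements and their action on the four embeddings
  obtain ⟨μ, hμa, hμb⟩ := exists_ringAut_fourCycle h4 hba hba' hτa hτb
  have hτa' : τ • conjugate a = conjugate a := by rw [smul_conjugate, hτa]
  have hτb' : τ • conjugate b = b := by rw [smul_conjugate, hτb, involutive_conjugate]
  have hμa' : μ • conjugate a = conjugate b := by rw [smul_conjugate, hμa]
  have hμb' : μ • conjugate b = a := by rw [smul_conjugate, hμb, involutive_conjugate]
  rw [isNondegenerateFamily_iff_forall_nat_symm]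
  intro f hf
  -- the balance identity, evaluated
  have hsum : ∀ g : ℂ ≃+* ℂ,
      ∑ x : (_ : Fin 2) × (K →+* ℂ), (f x : ℚ) * translateInd (familyType ![Φ, Ψ]) g x =
        (f ⟨0, a⟩ : ℚ) * translateInd Φ.1 g a + f ⟨0, conjugate a⟩ * translateInd Φ.1 g (conjugate a) +
          f ⟨0, b⟩ * translateInd Φ.1 g b + f ⟨0, conjugate b⟩ * translateInd Φ.1 g (conjugate b) +
        ((f ⟨1, a⟩ : ℚ) * translateInd Ψ.1 g a + f ⟨1, conjugate a⟩ * translateInd Ψ.1 g (conjugate a) +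
          f ⟨1, b⟩ * translateInd Ψ.1 g b + f ⟨1, conjugate b⟩ * translateInd Ψ.1 g (conjugate b)) := fun g => by
    rw [Fintype.sum_sigma, Fin.sum_univ_two, sum_eq_add_four h4 hba hba', sum_eq_add_four h4 hba hba']
    simp only [translateInd_familyType, Matrix.cons_val_zero, Matrix.cons_val_one]
  have htot : ∑ x : (_ : Fin 2) × (K →+* ℂ), (f x : ℚ) =
      (f ⟨0, a⟩ : ℚ) + f ⟨0, conjugate a⟩ + f ⟨0, b⟩ + f ⟨0, conjugate b⟩ +
        ((f ⟨1, a⟩ : ℚ) + f ⟨1, conjugate a⟩ + f ⟨1, b⟩ + f ⟨1, conjugate b⟩) := by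
    rw [Fintype.sum_sigma, Fin.sum_univ_two, sum_eq_add_four h4 hba hba', sum_eq_add_four h4 hba hba']
  have E1 := hf 1
  have E2 := hf τ
  have E3 := hf μ
  have E4 := hf (μ * τ)
  rw [hsum, htot] at E1 E2 E3 E4
  simp only [translateInd, one_smul, mul_smul, hτa, hτa', hτb, hτb', hμa, hμa', hμb, hμb', hΦa, hΦb, hΦna, hΦnb,
    hΨa, hΨb', hΨna, hΨnb, if_true, if_false, mul_one, mul_zero, add_zero, zero_add] at E1 E2 E3 E4
  have ka : (f ⟨0, conjugate a⟩ : ℚ) = f ⟨0, a⟩ := by linarith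
  have kb : (f ⟨0, conjugate b⟩ : ℚ) = f ⟨0, b⟩ := by linarith
  have ka' : (f ⟨1, conjugate a⟩ : ℚ) = f ⟨1, a⟩ := by linarith
  have kb' : (f ⟨1, conjugate b⟩ : ℚ) = f ⟨1, b⟩ := by linarith
  rintro ⟨i, s⟩
  change f ⟨i, conjugate s⟩ = f ⟨i, s⟩
  fin_cases i <;>
    rcases eq_or_eq_or_eq_or_eq h4 hba hba' s with h | h | h | h <;>
    simp only [h, involutive_conjugate K a, involutive_conjugate K b, Fin.zero_eta, Fin.mk_one] <;>
    first
    | exact_mod_cast ka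
    | exact_mod_cast ka.symm
    | exact_mod_cast kb
    | exact_mod_cast kb.symm
    | exact_mod_cast ka'
    | exact_mod_cast ka'.symm
    | exact_mod_cast kb'
    | exact_mod_cast kb'.symm

/-- **For a non-Galois quartic CM field every pair of CM types `Ψ ∉ {Φ, Φ̄}` is a nondegenerate family** — the
first nondegenerate family with two (CM-inequivalent, primitive) members; over a GALOIS CM field there is none
(`Summit.HodgeConjecture.CorCM.not_isNondegenerateFamily_of_two_le_card`).
[cite: MoonenZarhin1999LowDim, section "Hodge groups of simple abelian surfaces of CM-type"] -/
theorem isNondegenerateFamily_pair_of_not_isGalois (h4 : Module.finrank ℚ K = 4) (hK : ¬IsGalois ℚ K)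
    {Φ Ψ : CMType K} (h₁ : Ψ ≠ Φ) (h₂ : Ψ ≠ bar Φ) : IsNondegenerateFamily ![Φ, Ψ] := by
  obtain ⟨a, b, hba, hba', hΦ, hΨ⟩ := exists_pair_presentation h4 h₁ h₂
  obtain ⟨τ, hτa, hτb⟩ := exists_ringAut_smul_eq_self_smul_eq_conjugate_of_not_isGalois h4 hK hba hba'
  exact isNondegenerateFamily_pair h4 hba hba' hτa hτb hΦ hΨ

end Summit.HodgeConjecture.CorCM.QuarticCM

end
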